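import Summits.Ventures.Crystal3D.Theorems.StickyWulffConstantNoReconstructionGainExactCertificate
import Summits.Ventures.Crystal3D.Theorems.StickyWulffConstantNoReconstructionGainExactCompatible
import Summits.Ventures.Crystal3D.Theorems.StickyWulffConstantCoaxialWallLawFrame
import Summits.Ventures.Crystal3D.Theorems.StickyWulffConstantGenericWallFloorAffineSampleDeficit
import HarnessLib

/-!
# Films under lattice translations; slack; integrality (line `replication-exactness`, bricks for REPLICATION)

HONEST FRAMING. Part of the venture `Summits/Ventures/Crystal3D` (cell `crystal3d-full`), supports the
crux `NoReconstructionGain` (stmt-Ventures-19144, route `route-Ventures-StickyWulffConstant`), line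
`replication-exactness` (skeleton v2, lead wulff-p1 g17), bricks for the licence stub `stub_replication`
(`NoReconstructionGain → ExactZeroGain`):

* `isFilmOn_translate`, `plugCount_translate`, `contactDeficiency_translate` — TRANSLATION COVARIANCE: for
  `t ∈ Λ₀`, the translate `Q + t` of a film on `H(ν,s)` is a film on `H(ν, s + ⟪t,ν⟫)` with the same
  number of plugs and the same deficiency;
* `exists_film_slack` — SLACK: a film on `H(ν,s)` stays at distance `≥ 1` from every lattice site of
  height in `(s, s + δ]` for some `δ > 0` (only finitely many sites come within distance `< 1`);
* `film_height_gt` — a film ball lies above `s − 3/4` (covering radius);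
* `contactDeficiency_add_one_le_plugCount` — INTEGRALITY: a gaining film gains at least one
  (`D(Q) ∈ ℤ` because ordered contacts come in pairs, `two_mul_card_contactReps`).

WHAT THIS IS NOT: the replication itself (flat translations + assembly) is the next brick; rung F-C1 not
moved.
-/

noncomputable section

namespace Summit.Ventures.Crystal3D.Theorems

open Literature.MathematicalPhysics.StatisticalMechanics (fccStacking barlowStacking barlowPos constHagg
  mem_barlowStacking_iff contactDeficiency orderedContacts UniformlyDiscrete)
open scoped InnerProductSpace
open Finset

/-! ## Translation covariance -/

/-- Translating by a lattice vector moves the half-crystal `H(ν,s)` onto `H(ν, s + ⟪t,ν⟫)`. -/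
theorem mem_halfCrystal_translate_iff {ν t : EuclideanSpace ℝ (Fin 3)}
    (ht : t ∈ fccStacking 1 (Real.sqrt (2 / 3))) (s : ℝ) (p : EuclideanSpace ℝ (Fin 3)) :
    p ∈ halfCrystal ν (s + ⟪t, ν⟫_ℝ) ↔ p - t ∈ halfCrystal ν s := by
  constructor
  · rintro ⟨hp, hh⟩
    refine ⟨fcc_sub_site_mem hp ht, ?_⟩
    rw [inner_sub_left]; linarith
  · rintro ⟨hp, hh⟩
    refine ⟨by simpa using fcc_add_site_mem hp ht, ?_⟩
    rw [inner_sub_left] at hh; linarith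

/-- **Translation covariance of films.** -/
theorem isFilmOn_translate {ν t : EuclideanSpace ℝ (Fin 3)} (ht : t ∈ fccStacking 1 (Real.sqrt (2 / 3)))
    {s : ℝ} {Q : Finset (EuclideanSpace ℝ (Fin 3))} (hQ : IsFilmOn ν s Q) :
    IsFilmOn ν (s + ⟪t, ν⟫_ℝ) (Q.image fun q => q + t) := by
  classical
  refine ⟨?_, ?_⟩
  · intro q hq q' hq' hne
    obtain ⟨a, ha, rfl⟩ := Finset.mem_image.1 hq
    obtain ⟨b, hb, rfl⟩ := Finset.mem_image.1 hq'
    have hab : a ≠ b := by rintro rfl; exact hne rfl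
    rw [dist_add_right]
    exact hQ.1 a ha b hb hab
  · intro q hq p hp
    obtain ⟨a, ha, rfl⟩ := Finset.mem_image.1 hq
    have hp' := (mem_halfCrystal_translate_iff ht s p).1 hp
    have h := hQ.2 a ha (p - t) hp'
    have : dist (a + t) p = dist a (p - t) := by
      rw [dist_eq_norm, dist_eq_norm]; congr 1; abel
    rw [this]; exact h

/-- The plug set of a translated ball is the translated plug set. -/
theorem plugSet_translate {ν t : EuclideanSpace ℝ (Fin 3)} (ht : t ∈ fccStacking 1 (Real.sqrt (2 / 3)))
    (s : ℝ) (q : EuclideanSpace ℝ (Fin 3)) :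
    plugSet ν (s + ⟪t, ν⟫_ℝ) (q + t) = (fun p => p + t) '' plugSet ν s q := by
  ext p
  constructor
  · rintro ⟨hp, hd⟩
    refine ⟨p - t, ⟨(mem_halfCrystal_translate_iff ht s p).1 hp, ?_⟩, by abel⟩
    have : dist q (p - t) = dist (q + t) p := by
      rw [dist_eq_norm, dist_eq_norm]; congr 1; abel
    rw [this]; exact hd
  · rintro ⟨p', ⟨hp', hd⟩, rfl⟩
    refine ⟨(mem_halfCrystal_translate_iff ht s _).2 (by simpa using hp'), ?_⟩
    rw [dist_add_right]; exact hd

/-- **Translation covariance of the plug count.** -/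
theorem plugCount_translate {ν t : EuclideanSpace ℝ (Fin 3)} (ht : t ∈ fccStacking 1 (Real.sqrt (2 / 3)))
    (s : ℝ) (Q : Finset (EuclideanSpace ℝ (Fin 3))) :
    plugCount ν (s + ⟪t, ν⟫_ℝ) (Q.image fun q => q + t) = plugCount ν s Q := by
  classical
  unfold plugCount
  rw [Finset.sum_image (fun a _ b _ h => add_right_cancel h)]
  refine Finset.sum_congr rfl fun q _ => ?_
  rw [plugSet_translate ht s q]
  exact Set.ncard_image_of_injective _ (add_left_injective t)

/-- **Translation invariance of the deficiency.** -/
theorem contactDeficiency_translate (t : EuclideanSpace ℝ (Fin 3))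
    (Q : Finset (EuclideanSpace ℝ (Fin 3))) :
    contactDeficiency (Q.image fun q => q + t) = contactDeficiency Q :=
  contactDeficiency_image_of_isometry (isometry_add_right t) Q

/-! ## Heights of film balls and slack -/

/-- A film ball on `H(ν,s)` lies above `s − 3/4`: its nearest lattice site (within `1/√2`) is above the
cut. -/
theorem film_height_gt {ν : EuclideanSpace ℝ (Fin 3)} (hν : ‖ν‖ = 1) {s : ℝ}
    {Q : Finset (EuclideanSpace ℝ (Fin 3))} (hQ : IsFilmOn ν s Q) {q : EuclideanSpace ℝ (Fin 3)}
    (hq : q ∈ Q) : s - 3 / 4 < ⟪q, ν⟫_ℝ := by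
  obtain ⟨z, hzΛ, hz⟩ := exists_fcc_dist_sq_le_half q
  have hdz : dist q z ^ 2 ≤ 1 / 2 := by rw [dist_eq_norm]; exact hz
  have hd34 : dist q z ≤ 3 / 4 := by nlinarith [dist_nonneg (x := q) (y := z)]
  have hzs : s < ⟪z, ν⟫_ℝ := by
    by_contra h
    have h1 := hQ.2 q hq z ⟨hzΛ, not_lt.1 h⟩
    linarith
  have h2 := abs_inner_sub_le_dist hν z q
  rw [dist_comm] at h2
  have h3 := (le_abs_self _).trans h2
  linarith

/-- **Slack.**  A finite configuration stays at distance `≥ 1` from every lattice site of height in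
`(s, s + δ]`, for some `0 < δ ≤ 1` (only finitely many sites come within distance `< 1` of it). -/
theorem exists_film_slack (ν : EuclideanSpace ℝ (Fin 3)) (s : ℝ)
    (Q : Finset (EuclideanSpace ℝ (Fin 3))) :
    ∃ δ : ℝ, 0 < δ ∧ δ ≤ 1 ∧ ∀ z ∈ fccStacking 1 (Real.sqrt (2 / 3)),
      s < ⟪z, ν⟫_ℝ → ⟪z, ν⟫_ℝ ≤ s + δ → ∀ q ∈ Q, 1 ≤ dist q z := by
  classical
  -- the finitely many sites that come within distance `< 1` of the film
  set B : Finset (EuclideanSpace ℝ (Fin 3)) :=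
    Q.biUnion fun q => (fcc_uniformlyDiscrete.finite_inter_closedBall q 1).toFinset with hB
  set Bad := B.filter fun z => s < ⟪z, ν⟫_ℝ with hBad
  have hmemBad : ∀ z ∈ fccStacking 1 (Real.sqrt (2 / 3)), s < ⟪z, ν⟫_ℝ → ∀ q ∈ Q, dist q z < 1 →
      z ∈ Bad := by
    intro z hzΛ hzs q hq hlt
    rw [hBad, Finset.mem_filter]
    refine ⟨?_, hzs⟩
    rw [hB, Finset.mem_biUnion]
    exact ⟨q, hq, (Set.Finite.mem_toFinset _).2
      ⟨hzΛ, Metric.mem_closedBall.2 (by rw [dist_comm]; exact hlt.le)⟩⟩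
  by_cases hne : Bad.Nonempty
  · -- `δ` = half the least height excess of a nearby site above the cut (capped at 1)
    obtain ⟨z₀, hz₀, hmin⟩ := Bad.exists_min_image (fun z => ⟪z, ν⟫_ℝ) hne
    have hz₀s : s < ⟪z₀, ν⟫_ℝ := (Finset.mem_filter.1 hz₀).2
    refine ⟨min ((⟪z₀, ν⟫_ℝ - s) / 2) 1, lt_min (by linarith) one_pos, min_le_right _ _, ?_⟩
    intro z hzΛ hzs hzδ q hq
    by_contra hlt
    push Not at hlt
    have h1 := hmin z (hmemBad z hzΛ hzs q hq hlt)
    have h2 := min_le_left ((⟪z₀, ν⟫_ℝ - s) / 2) 1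
    linarith
  · refine ⟨1, one_pos, le_rfl, ?_⟩
    intro z hzΛ hzs _ q hq
    by_contra hlt
    push Not at hlt
    exact hne ⟨z, hmemBad z hzΛ hzs q hq hlt⟩

/-! ## Integrality -/

/-- The deficiency of a finite configuration is an integer: ordered contacts come in pairs. -/
theorem exists_int_contactDeficiency (Q : Finset (EuclideanSpace ℝ (Fin 3))) :
    ∃ n : ℤ, contactDeficiency Q = n := by
  classical
  have h := two_mul_card_contactReps Q
  refine ⟨6 * (Q.card : ℤ) -
    (((Q ×ˢ Q).filter fun pq => dist pq.1 pq.2 = 1 ∧ WellOrderingRel pq.1 pq.2).card : ℤ), ?_⟩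
  unfold contactDeficiency
  have h' : (orderedContacts Q : ℝ) =
      2 * (((Q ×ˢ Q).filter fun pq => dist pq.1 pq.2 = 1 ∧ WellOrderingRel pq.1 pq.2).card : ℕ) := by
    exact_mod_cast h.symm
  rw [h']
  push_cast
  ring

/-- **Integrality: a gaining film gains at least one bond.** -/
theorem contactDeficiency_add_one_le_plugCount {ν : EuclideanSpace ℝ (Fin 3)} {s : ℝ}
    {Q : Finset (EuclideanSpace ℝ (Fin 3))} (h : contactDeficiency Q < plugCount ν s Q) :
    contactDeficiency Q + 1 ≤ plugCount ν s Q := by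
  obtain ⟨n, hn⟩ := exists_int_contactDeficiency Q
  rw [hn] at h ⊢
  have h1 : n < (plugCount ν s Q : ℤ) := by exact_mod_cast h
  have h2 : n + 1 ≤ (plugCount ν s Q : ℤ) := h1
  exact_mod_cast h2

end Summit.Ventures.Crystal3D.Theorems

end
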